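import Mathlib.Tactic.Group
import Literature.AnabelianGeometry.SemiGraphs.ArithBTempOuterModel
import Literature.AnabelianGeometry.SemiGraphs.SubgroupPresentationArithLevels
import HarnessLib

/-!
# [SemiAnbd] Thm 5.4 (iii) at the outer models — CONTINUITY of the canonical `B^temp(φ)` for the
# tempered LEVEL topologies (the law `hcont` of the integrated Thm 5.4 line), general regime

Mochizuki, *Semi-graphs of anabelioids*, Publ. RIMS **42** (2006), §0 p. 5 (`G ⋊^out J`), §5 Prop 5.2 (iv)
p. 64 ("natural exact sequences `1 → Π^temp_𝒢 → Π^temp_𝔊 → Π_A → 1`"), Thm 5.4 (iii) p. 66 ("the homomorphism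
`Π^temp_𝔊 → Π^temp_ℍ` induced by `φ`" — a CONTINUOUS homomorphism of tempered groups)
[cite: MochizukiSemiAnbd2006, Thm 5.4 (iii) p.66].

PROOF-ONLY file (cell abc-iut, layer L3, T54 board, row «T54iii·hcont»; seat abc-iut-w4-d089 gen 8).  No
definition, no new named fact.  abc-iut-w4-d053's `outerSemidirectProductMap ρG ρH e f hcompat hZ`
(`ArithBTempOuterModel.lean`) is the canonical `B^temp(φ)` between the outer models `G ⋊^out J → H ⋊^out J′`;
its continuity was derived so far only in the discrete-quotient regime (`ι_G` with OPEN image,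
`continuous_outerSemidirectProductMap_of_isOpen_range`).  Here it is proved for the genuine tempered LEVEL
topologies of abc-iut-w6-d070 (`arithLevelTopology`: neighbourhood basis of `1` = the arithmetic level kernels
`levelKer (N n) ⊓ aug⁻¹ U` of abc-iut-L3-d4), for INFINITE `Π_A`, by group theory + one compactness argument:

* `SubgroupPresentation.exists_map_H_eq_map_conj_of_mem_levelKer` — an element of the level kernel
  `levelKer L` carries every vertex group `H_w` of the presentation to an `L`-conjugate `c H_w c⁻¹`, `c ∈ L`
  (its vertex conjugator lies in `L · H_w`); `…_map_conj_…` the same for the conjugates `g₀ H_w g₀⁻¹`;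
* `mem_commensurator_of_map_conj_le` — an element conjugating one finite-index subgroup of `K` onto another
  lies in the commensurator of `K`;
* **`continuous_outerSemidirectProductMap_of_levelKer`** — THE THEOREM (hypotheses: level-kernel
  neighbourhoods on both outer models, `f` compatible with the levels, `e` continuous, the target's
  congruence-continuity `hK1′`, ONE vertex group `H_{w₀}` mapped by `f` onto a finite-index subgroup of a
  COMPACT commensurably terminal `H₀′ ≤ H` moved by the target level kernels within its `N′ m`-conjugates).
  Proof: for `p` near `1`, `hK1′` writes `B p = ι′(h) · q`, `q ∈ levelKer′ (N′ m₁)`; `[h, f y] ∈ N′ m₁` and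
  `h ∈ N′ m₁ · H₀′ · N′ m₁` (vertex clauses + commensurable terminality); the closed sets
  `C m := {c | ∀ y, [c, f y] ∈ N′ m}` decrease to the centraliser of `f(G)` = `1` (`hZ`), so by compactness
  some `C m₁ ∩ H₀′` lies in the open subgroup `ι′⁻¹ (levelKer′ (N′ m))`, whence `B p ∈ levelKer′ (N′ m)`.

Nothing here bears on [IUTchIII] Cor. 3.12; typed ≠ proved elsewhere; no side taken.
-/

namespace Literature.AnabelianGeometry.SemiGraphs

open _root_.CategoryTheory _root_.Topology _root_.Filter
open Literature.AnabelianGeometry.EtaleTheta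
open scoped Pointwise

/-! ### The vertex conjugators of level-kernel elements lie in `L · H_w` -/

namespace SemiGraph

namespace SubgroupPresentation

universe u v

variable {𝔾 : SemiGraph.{u}} {Γ : Type u} [Group Γ] {E : Type v} [Group E]
variable (P : SubgroupPresentation 𝔾 Γ) {Φ : E →* MulAut Γ} {σ : E →* Aut 𝔾}
variable (hP : P.IsArithCompatible Φ σ) (L : Subgroup Γ)
  (hL : ∀ (e : E) (x : Γ), x ∈ L → Φ e x ∈ L)

/-- **An element of the level kernel moves every vertex group within its `L`-conjugacy class**: for
`e ∈ levelKer L` and a vertex `w`, `Φ_e(H_w) = c H_w c⁻¹` for some `c ∈ L` (the vertex conjugator of `e` at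
`w` lies in `L · H_w`: `e` fixes the vertex `H_w · 1 · L` of the level-`L` coset semi-graph).
[cite: MochizukiSemiAnbd2006, Prop 5.2 (iv), p. 64] -/
theorem exists_map_H_eq_map_conj_of_mem_levelKer [L.Normal] {e : E} (he : e ∈ P.levelKer hP L hL)
    (w : 𝔾.Vertex) :
    ∃ c ∈ L, (P.H w).map (Φ e).toMonoidHom = (P.H w).map (MulAut.conj c).toMonoidHom := by
  rw [mem_levelKer_iff] at he
  obtain ⟨hact, hσ, -⟩ := he
  obtain ⟨k, hk⟩ := hP.exists_isVConj e w
  have hw : (σ e).hom.vertexMap w = w := by rw [hσ]; rfl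
  -- `e` fixes the vertex `H_w 1 L`, i.e. `H_w k⁻¹ L = H_w L`
  have hfix := congrArg (fun f : Aut (P.cosetGraph L) => f.hom.vertexMap (P.vMk L w 1)) hact
  have hfix' : P.vMk L ((σ e).hom.vertexMap w) (k⁻¹ * Φ e 1) = P.vMk L w 1 := by
    rw [← P.arithAct_vertexMap_vMk hP L hL hk]; exact hfix
  have hz : P.vMk L w k⁻¹ = P.vMk L w 1 := by
    rw [← hfix', map_one, mul_one]; exact (P.vMk_eq L hw rfl).symm
  have key : DoubleCoset.mk (P.H w) L k⁻¹ = DoubleCoset.mk (P.H w) L 1 := by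
    have := eq_of_heq (Sigma.mk.inj_iff.mp hz).2
    simpa using this
  obtain ⟨h, hh, c, hc, hhc⟩ := (DoubleCoset.eq _ _ _ _).mp key
  -- `1 = h * k⁻¹ * c`, so `k = c * h`
  have hk' : k = c * h := by
    have : k⁻¹ = h⁻¹ * c⁻¹ := by
      calc k⁻¹ = h⁻¹ * (h * k⁻¹ * c) * c⁻¹ := by group
        _ = h⁻¹ * c⁻¹ := by rw [← hhc]; group
    have := congrArg (·⁻¹) this
    simpa [mul_inv_rev] using this
  refine ⟨c, hc, ?_⟩
  -- `Φ_e(H_w) = k H_w k⁻¹ = c h H_w h⁻¹ c⁻¹ = c H_w c⁻¹`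
  have hk1 : ∀ x, x ∈ P.H w ↔ k⁻¹ * Φ e x * k ∈ P.H w := fun x => by
    have := hk x; rwa [hw] at this
  ext x
  constructor
  · rintro ⟨y, hy, rfl⟩
    have h1 : k⁻¹ * Φ e y * k ∈ P.H w := (hk1 y).mp hy
    refine ⟨h * (k⁻¹ * Φ e y * k) * h⁻¹, mul_mem (mul_mem hh h1) (inv_mem hh), ?_⟩
    change c * (h * (k⁻¹ * (Φ e) y * k) * h⁻¹) * c⁻¹ = (Φ e) y
    rw [hk']; group
  · rintro ⟨y, hy, rfl⟩
    refine ⟨(Φ e)⁻¹ (c * y * c⁻¹), ?_, by simp⟩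
    change (Φ e)⁻¹ (c * y * c⁻¹) ∈ P.H w
    rw [hk1, MulAut.apply_inv_self, hk']
    have : (c * h)⁻¹ * (c * y * c⁻¹) * (c * h) = h⁻¹ * y * h := by group
    rw [this]
    exact mul_mem (mul_mem (inv_mem hh) hy) hh

/-- The same for the CONJUGATES `g₀ H_w g₀⁻¹` of the vertex groups: `Φ_e(g₀ H_w g₀⁻¹) = μ (g₀ H_w g₀⁻¹) μ⁻¹`
with `μ = (Φ_e(g₀) g₀⁻¹)(g₀ c g₀⁻¹) ∈ L`. [cite: MochizukiSemiAnbd2006, Prop 5.2 (iv), p. 64] -/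
theorem exists_map_conj_H_eq_map_conj_of_mem_levelKer [L.Normal] {e : E} (he : e ∈ P.levelKer hP L hL)
    (w : 𝔾.Vertex) (g₀ : Γ) :
    ∃ μ ∈ L, ((P.H w).map (MulAut.conj g₀).toMonoidHom).map (Φ e).toMonoidHom =
      ((P.H w).map (MulAut.conj g₀).toMonoidHom).map (MulAut.conj μ).toMonoidHom := by
  obtain ⟨c, hc, hcw⟩ := P.exists_map_H_eq_map_conj_of_mem_levelKer hP L hL he w
  have hcm : Φ e g₀ * g₀⁻¹ ∈ L := ((P.mem_levelKer_iff hP L hL).mp he).2.2 g₀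
  refine ⟨Φ e g₀ * g₀⁻¹ * (g₀ * c * g₀⁻¹), mul_mem hcm (‹L.Normal›.conj_mem c hc g₀), ?_⟩
  have h1 : ((P.H w).map (MulAut.conj g₀).toMonoidHom).map (Φ e).toMonoidHom =
      ((P.H w).map (Φ e).toMonoidHom).map (MulAut.conj (Φ e g₀)).toMonoidHom := by
    rw [Subgroup.map_map, Subgroup.map_map]
    congr 1
    ext y
    simp [map_mul, map_inv]
  rw [h1, hcw, Subgroup.map_map, Subgroup.map_map]
  congr 1
  ext y
  simp only [MonoidHom.coe_comp, MulEquiv.coe_toMonoidHom, Function.comp_apply, MulAut.conj_apply]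
  group

end SubgroupPresentation

end SemiGraph

/-! ### Commensurators: conjugating one finite-index subgroup of `K` onto another -/

section Commensurator

variable {H : Type*} [Group H]

/-- If `t` conjugates a finite-index subgroup `X ≤ K` onto a finite-index subgroup of `K`, then `t` commensurates
`K`. [cite: MochizukiSemiAnbd2006, Thm 3.7 (ii), p. 40] -/
theorem mem_commensurator_of_map_conj_le {K X : Subgroup H} (t : H) (hX : X ≤ K) (hXi : X.relIndex K ≠ 0)
    (hY : X.map (MulAut.conj t).toMonoidHom ≤ K)
    (hYi : (X.map (MulAut.conj t).toMonoidHom).relIndex K ≠ 0) :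
    t ∈ Subgroup.Commensurable.commensurator K := by
  rw [Subgroup.Commensurable.commensurator_mem_iff]
  have hsmul : ConjAct.toConjAct t • K = K.map (MulAut.conj t).toMonoidHom := rfl
  rw [hsmul]
  constructor
  · -- `t X t⁻¹ ≤ t K t⁻¹ ⊓ K` has finite index in `K`
    refine fun h0 => hYi (Nat.eq_zero_of_zero_dvd ?_)
    rw [← h0]
    exact Subgroup.relIndex_dvd_of_le_left K (Subgroup.map_mono hX)
  · -- `t X t⁻¹ ≤ K ⊓ t K t⁻¹` has finite index in `t K t⁻¹`
    refine fun h0 => hXi (Nat.eq_zero_of_zero_dvd ?_)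
    have hinj : Function.Injective (MulAut.conj t).toMonoidHom := (MulAut.conj t).injective
    rw [← Subgroup.relIndex_map_map_of_injective X K hinj, ← h0]
    exact Subgroup.relIndex_dvd_of_le_left _ hY

end Commensurator

/-! ### Continuity of `B^temp(φ)` for the level topologies -/

section Continuity

universe u u'

variable {𝔾 : SemiGraph.{u}} {G : Type u} [Group G] [TopologicalSpace G]
  {ℍ : SemiGraph.{u'}} {H : Type u'} [Group H] [TopologicalSpace H] [IsTopologicalGroup H]
  {J : Type*} [Group J] [TopologicalSpace J]
  {J' : Type*} [Group J'] [TopologicalSpace J']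
  (ρG : J →* TopOut G) (ρH : J' →* TopOut H) (e : J →* J') (f : G →* H)
  (hcompat : ∀ p : outerSemidirectProduct ρG, ∃ β' : contMulAut H,
    TopOut.mk H β' = ρH (e (outerSemidirectProductSnd ρG p)) ∧
      ∀ y, (β' : MulAut H) (f y) = f ((p.1.1 : MulAut G) y))
  (hZ : ∀ h : H, (∀ y : G, h * f y * h⁻¹ = f y) → h = 1)

/-- **Continuity of `B^temp(φ)` at the outer models for the tempered LEVEL topologies** (Thm 5.4 (iii):
"the homomorphism `Π^temp_𝔊 → Π^temp_ℍ` induced by `φ`" is a continuous homomorphism of tempered groups):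
with level-kernel topologies on `G ⋊^out J` (`levelKer (N n)` open, `aug` continuous) and `H ⋊^out J′`
(`levelKer′ (N′ m) ⊓ aug′⁻¹ U′` a basis of `𝓝 1`), `f` compatible with the levels, `e` continuous, `hK1′` on
the target, and ONE vertex group `H_{w₀}` carried by `f` onto a finite-index subgroup of a compact,
commensurably terminal `H₀′ ≤ H` moved by the target level kernels within its `N′ m`-conjugacy class,
`outerSemidirectProductMap ρG ρH e f hcompat hZ` is continuous. [cite: MochizukiSemiAnbd2006, Thm 5.4 (iii) p.66] -/
theorem continuous_outerSemidirectProductMap_of_levelKer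
    (P : SemiGraph.SubgroupPresentation 𝔾 G) (baseActG : J →* Aut 𝔾)
    (hP : P.IsArithCompatible
      (((contMulAut G).subtype.comp (MonoidHom.fst (contMulAut G) J)).comp
        (outerSemidirectProduct ρG).subtype)
      (baseActG.comp (outerSemidirectProductSnd ρG)))
    (N : ℕ → Subgroup G) [hNn : ∀ n, (N n).Normal]
    (hNst : ∀ (n : ℕ) (p : outerSemidirectProduct ρG) (x : G), x ∈ N n →
      (((contMulAut G).subtype.comp (MonoidHom.fst (contMulAut G) J)).comp
        (outerSemidirectProduct ρG).subtype) p x ∈ N n)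
    [τG : TopologicalSpace (outerSemidirectProduct ρG)] [IsTopologicalGroup (outerSemidirectProduct ρG)]
    (hKopen : ∀ n, IsOpen (P.levelKer hP (N n) (hNst n) : Set (outerSemidirectProduct ρG)))
    (haug : Continuous (outerSemidirectProductSnd ρG))
    (P' : SemiGraph.SubgroupPresentation ℍ H) (baseActH : J' →* Aut ℍ)
    (hP' : P'.IsArithCompatible
      (((contMulAut H).subtype.comp (MonoidHom.fst (contMulAut H) J')).comp
        (outerSemidirectProduct ρH).subtype)
      (baseActH.comp (outerSemidirectProductSnd ρH)))
    (N' : ℕ → Subgroup H) [hN'n : ∀ m, (N' m).Normal]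
    (hN'st : ∀ (m : ℕ) (q : outerSemidirectProduct ρH) (x : H), x ∈ N' m →
      (((contMulAut H).subtype.comp (MonoidHom.fst (contMulAut H) J')).comp
        (outerSemidirectProduct ρH).subtype) q x ∈ N' m)
    (hN'anti : Antitone N') (hN'open : ∀ m, IsOpen (N' m : Set H))
    (hN'sep : ∀ x : H, (∀ m, x ∈ N' m) → x = 1)
    [τH : TopologicalSpace (outerSemidirectProduct ρH)] [IsTopologicalGroup (outerSemidirectProduct ρH)]
    (hbasis : (𝓝 (1 : outerSemidirectProduct ρH)).HasBasis (fun _ : ℕ × OpenNormalSubgroup J' => True)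
      (fun mU => ((P'.levelKer hP' (N' mU.1) (hN'st mU.1) ⊓
        mU.2.toSubgroup.comap (outerSemidirectProductSnd ρH) :
          Subgroup (outerSemidirectProduct ρH)) : Set (outerSemidirectProduct ρH))))
    (hK1' : ∀ m, IsOpen (((P'.levelKer hP' (N' m) (hN'st m)).map (outerSemidirectProductSnd ρH) :
      Subgroup J') : Set J'))
    (hNf : ∀ m, ∃ n, N n ≤ (N' m).comap f) (he : Continuous e)
    (H₀' : Subgroup H) (hcpt : IsCompact (H₀' : Set H))
    (hCT : Subgroup.Commensurable.commensurator H₀' = H₀')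
    (hlev : ∀ (m : ℕ) (q : outerSemidirectProduct ρH), q ∈ P'.levelKer hP' (N' m) (hN'st m) →
      ∃ μ ∈ N' m, H₀'.map ((((contMulAut H).subtype.comp (MonoidHom.fst (contMulAut H) J')).comp
        (outerSemidirectProduct ρH).subtype) q).toMonoidHom = H₀'.map (MulAut.conj μ).toMonoidHom)
    (w₀ : 𝔾.Vertex) (hle : (P.H w₀).map f ≤ H₀') (hfi : ((P.H w₀).map f).relIndex H₀' ≠ 0) :
    Continuous (outerSemidirectProductMap ρG ρH e f hcompat hZ) := by
  have hZ' : Subgroup.center H = ⊥ := center_eq_bot_of_centraliserFree f hZ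
  have hinj := toOuterSemidirectProduct_injective ρH hZ'
  -- the inner action on the target
  have hιΦ : ∀ g : H, (((contMulAut H).subtype.comp (MonoidHom.fst (contMulAut H) J')).comp
      (outerSemidirectProduct ρH).subtype) (toOuterSemidirectProduct ρH g) = MulAut.conj g := fun g => rfl
  have hισ : ∀ g : H, (baseActH.comp (outerSemidirectProductSnd ρH)) (toOuterSemidirectProduct ρH g) = 1 :=
    fun g => by simp
  apply continuous_of_continuousAt_one
  rw [ContinuousAt, map_one, hbasis.tendsto_right_iff]
  rintro ⟨m, U'⟩ -
  -- the open subgroup `W' := ι'⁻¹ (levelKer' (N' m)) ⊇ N' m`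
  set W' : Subgroup H := (P'.levelKer hP' (N' m) (hN'st m)).comap (toOuterSemidirectProduct ρH) with hW'
  have hNW' : N' m ≤ W' := P'.le_comap_levelKer hP' (N' m) (hN'st m) (toOuterSemidirectProduct ρH) hιΦ hισ
  have hW'open : IsOpen (W' : Set H) := Subgroup.isOpen_mono hNW' (hN'open m)
  -- the closed, antitone sets `C k := {c | ∀ y, [c, f y] ∈ N' k}`, with `⋂ C k ∩ H₀' ⊆ {1}`
  set C : ℕ → Set H := fun k => {c | ∀ y : G, c * f y * c⁻¹ * (f y)⁻¹ ∈ N' k} with hC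
  have hCclosed : ∀ k, IsClosed (C k) := by
    intro k
    have : C k = ⋂ y : G, (fun c : H => c * f y * c⁻¹ * (f y)⁻¹) ⁻¹' (N' k : Set H) := by
      ext c; simp [C, Set.mem_iInter]
    rw [this]
    exact isClosed_iInter fun y => ((N' k).isClosed_of_isOpen (hN'open k)).preimage (by fun_prop)
  have hCanti : ∀ {k k'}, k ≤ k' → C k' ⊆ C k := fun hkk' c hc y => hN'anti hkk' (hc y)
  have hCdir : Directed (· ⊇ ·) C := fun k k' => ⟨max k k', hCanti (le_max_left _ _), hCanti (le_max_right _ _)⟩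
  have hCiff : ∀ (k : ℕ) (c : H), c ∈ C k ↔
      ∀ y, (QuotientGroup.mk c : H ⧸ N' k) * QuotientGroup.mk (f y) =
        QuotientGroup.mk (f y) * QuotientGroup.mk c := by
    intro k c
    refine forall_congr' fun y => ?_
    rw [← QuotientGroup.eq_one_iff, QuotientGroup.mk_mul, QuotientGroup.mk_mul, QuotientGroup.mk_mul,
      QuotientGroup.mk_inv, QuotientGroup.mk_inv, mul_inv_eq_one, mul_inv_eq_iff_eq_mul]
  have hCmul : ∀ (k : ℕ) {a b x : H}, a ∈ N' k → b ∈ N' k → x ∈ C k → a * x * b ∈ C k := by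
    intro k a b x ha hb hx
    rw [hCiff] at hx ⊢
    intro y
    have ha' : (QuotientGroup.mk a : H ⧸ N' k) = 1 := (QuotientGroup.eq_one_iff a).mpr ha
    have hb' : (QuotientGroup.mk b : H ⧸ N' k) = 1 := (QuotientGroup.eq_one_iff b).mpr hb
    rw [QuotientGroup.mk_mul, QuotientGroup.mk_mul, ha', hb', one_mul, mul_one]
    exact hx y
  -- compactness of `H₀'`: some `C k₀ ∩ H₀'` lies in `W'`
  obtain ⟨k₀, hk₀⟩ : ∃ k, (H₀' : Set H) ∩ (W' : Set H)ᶜ ∩ C k = ∅ := by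
    refine (hcpt.inter_right hW'open.isClosed_compl).elim_directed_family_closed C hCclosed ?_ hCdir
    rw [Set.eq_empty_iff_forall_notMem]
    rintro c ⟨⟨-, hcW⟩, hcC⟩
    apply hcW
    rw [Set.mem_iInter] at hcC
    have hc1 : c = 1 := hZ c fun y => by
      have : c * f y * c⁻¹ * (f y)⁻¹ = 1 := hN'sep _ fun k => hcC k y
      rwa [mul_inv_eq_one] at this
    exact hc1 ▸ W'.one_mem
  -- the levels: `m₁ ≥ m, k₀` on the target, `n` on the source with `f (N n) ≤ N' m₁`
  obtain ⟨n, hn⟩ := hNf (max m k₀)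
  -- the source neighbourhood `levelKer (N n) ∩ (e ∘ aug)⁻¹ (aug' (levelKer' (N' m₁)) ∩ U')`
  have hS : ((P.levelKer hP (N n) (hNst n) : Set (outerSemidirectProduct ρG)) ∩
      (e.comp (outerSemidirectProductSnd ρG)) ⁻¹'
        ((((P'.levelKer hP' (N' (max m k₀)) (hN'st (max m k₀))).map (outerSemidirectProductSnd ρH) :
          Subgroup J') : Set J') ∩ (U'.toSubgroup : Set J'))) ∈ 𝓝 (1 : outerSemidirectProduct ρG) := by
    refine ((hKopen n).inter (((hK1' (max m k₀)).inter U'.toOpenSubgroup.isOpen).preimage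
      (he.comp haug))).mem_nhds ⟨Subgroup.one_mem _, ?_⟩
    rw [Set.mem_preimage, Function.comp_apply, map_one, map_one]
    exact ⟨Subgroup.one_mem _, U'.toSubgroup.one_mem⟩
  refine Filter.mem_of_superset hS ?_
  rintro p ⟨hp, hpV, hpU⟩
  rw [SetLike.mem_coe] at hp hpU
  rw [SetLike.mem_coe, Subgroup.mem_map] at hpV
  obtain ⟨q, hq, hqe⟩ := hpV
  -- `B p = ι'(h) · q`
  have hker : outerSemidirectProductMap ρG ρH e f hcompat hZ p * q⁻¹ ∈ (outerSemidirectProductSnd ρH).ker := by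
    rw [MonoidHom.mem_ker, map_mul, map_inv, outerSemidirectProductSnd_outerSemidirectProductMap, hqe,
      MonoidHom.comp_apply, mul_inv_cancel]
  rw [← range_toOuterSemidirectProduct_eq_ker] at hker
  obtain ⟨h, hh⟩ := hker
  have hBp : outerSemidirectProductMap ρG ρH e f hcompat hZ p = toOuterSemidirectProduct ρH h * q := by
    rw [hh, inv_mul_cancel_right]
  -- the key identity `h · φ_q (f y) · h⁻¹ = f (φ_p y)`
  have hkey : ∀ y : G, h * (q.1.1 : MulAut H) (f y) * h⁻¹ = f ((p.1.1 : MulAut G) y) := by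
    intro y
    have hc := conj_outerSemidirectProductMap_toOuterSemidirectProduct ρG ρH e f hcompat hZ p y
    apply hinj
    rw [map_mul, map_mul, map_inv, ← conj_toOuterSemidirectProduct ρH q (f y), ← hc, hBp]
    group
  -- levels of `p` and `q`: `φ_p ≡ id mod N n`, `φ_q ≡ id mod N' m₁`
  have hνp : ∀ y : G, (p.1.1 : MulAut G) y * y⁻¹ ∈ N n := ((P.mem_levelKer_iff hP _ _).mp hp).2.2
  have hνq : ∀ z : H, (q.1.1 : MulAut H) z * z⁻¹ ∈ N' (max m k₀) :=
    ((P'.mem_levelKer_iff hP' _ _).mp hq).2.2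
  -- (A) `h ∈ C m₁`
  have hhC : h ∈ C (max m k₀) := by
    rw [hCiff]
    intro y
    have h1 : (QuotientGroup.mk ((q.1.1 : MulAut H) (f y)) : H ⧸ N' (max m k₀)) = QuotientGroup.mk (f y) :=
      QuotientGroup.eq_iff_div_mem.mpr (by rw [div_eq_mul_inv]; exact hνq (f y))
    have h2 : (QuotientGroup.mk (f ((p.1.1 : MulAut G) y)) : H ⧸ N' (max m k₀)) = QuotientGroup.mk (f y) :=
      QuotientGroup.eq_iff_div_mem.mpr (by
        rw [div_eq_mul_inv, ← map_inv, ← map_mul]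
        exact hn (hνp y))
    have h3 := congrArg (QuotientGroup.mk (s := N' (max m k₀))) (hkey y)
    simp only [QuotientGroup.mk_mul, QuotientGroup.mk_inv, h1, h2] at h3
    exact mul_inv_eq_iff_eq_mul.mp h3
  -- (B) `h ∈ N' m₁ · H₀' · N' m₁`: the vertex clauses and commensurable terminality
  obtain ⟨c, hc, hcH⟩ := P.exists_map_H_eq_map_conj_of_mem_levelKer hP (N n) (hNst n) hp w₀
  obtain ⟨μ, hμ, hμH⟩ := hlev (max m k₀) q hq
  have hfc : f c ∈ N' (max m k₀) := hn hc
  -- `t := (f c)⁻¹ h μ` conjugates `μ⁻¹ φ_q(f H_{w₀}) μ ≤ H₀'` onto `f H_{w₀}`; so `t⁻¹` commensurates `H₀'`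
  have hXeq : ((P.H w₀).map f).map (MulAut.conj ((f c)⁻¹ * h * μ)⁻¹).toMonoidHom =
      (((P.H w₀).map f).map (q.1.1 : MulAut H).toMonoidHom).map (MulAut.conj μ⁻¹).toMonoidHom := by
    ext z
    simp only [Subgroup.mem_map, MulEquiv.coe_toMonoidHom, MulAut.conj_apply, exists_exists_and_eq_and]
    constructor
    · rintro ⟨x, hx, rfl⟩
      -- `c x c⁻¹ = φ_p x''` with `x'' ∈ H_{w₀}`
      have hcx : c * x * c⁻¹ ∈ (P.H w₀).map (p.1.1 : MulAut G).toMonoidHom := by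
        have : c * x * c⁻¹ ∈ (P.H w₀).map (MulAut.conj c).toMonoidHom := ⟨x, hx, rfl⟩
        change c * x * c⁻¹ ∈ (P.H w₀).map ((((contMulAut G).subtype.comp
          (MonoidHom.fst (contMulAut G) J)).comp (outerSemidirectProduct ρG).subtype) p).toMonoidHom
        rwa [hcH]
      obtain ⟨x'', hx'', hpx⟩ := hcx
      refine ⟨x'', hx'', ?_⟩
      have hk := hkey x''
      change (p.1.1 : MulAut G) x'' = c * x * c⁻¹ at hpx
      rw [hpx, map_mul, map_mul, map_inv] at hk
      have hk' : (q.1.1 : MulAut H) (f x'') = h⁻¹ * (f c * f x * (f c)⁻¹) * h := by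
        rw [← hk]; group
      rw [hk']
      group
    · rintro ⟨x'', hx'', rfl⟩
      have hpx : (p.1.1 : MulAut G) x'' ∈ (P.H w₀).map (MulAut.conj c).toMonoidHom := by
        rw [← hcH]
        exact ⟨x'', hx'', rfl⟩
      obtain ⟨x, hx, hcx⟩ := hpx
      refine ⟨x, hx, ?_⟩
      have hk := hkey x''
      change c * x * c⁻¹ = (p.1.1 : MulAut G) x'' at hcx
      rw [← hcx, map_mul, map_mul, map_inv] at hk
      have hk' : (q.1.1 : MulAut H) (f x'') = h⁻¹ * (f c * f x * (f c)⁻¹) * h := by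
        rw [← hk]; group
      rw [hk']
      group
  have hH₀eq : H₀' = (H₀'.map (q.1.1 : MulAut H).toMonoidHom).map (MulAut.conj μ⁻¹).toMonoidHom := by
    change H₀' = (H₀'.map ((((contMulAut H).subtype.comp (MonoidHom.fst (contMulAut H) J')).comp
      (outerSemidirectProduct ρH).subtype) q).toMonoidHom).map (MulAut.conj μ⁻¹).toMonoidHom
    rw [hμH, Subgroup.map_map]
    conv_lhs => rw [← Subgroup.map_id H₀']
    congr 1
    ext z
    simp only [MonoidHom.id_apply, MonoidHom.coe_comp, MulEquiv.coe_toMonoidHom, Function.comp_apply,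
      MulAut.conj_apply]
    group
  have htmem : ((f c)⁻¹ * h * μ)⁻¹ ∈ Subgroup.Commensurable.commensurator H₀' := by
    refine mem_commensurator_of_map_conj_le ((f c)⁻¹ * h * μ)⁻¹ hle hfi ?_ ?_
    · rw [hXeq]
      conv_rhs => rw [hH₀eq]
      exact Subgroup.map_mono (Subgroup.map_mono hle)
    · rw [hXeq]
      rw [hH₀eq, Subgroup.relIndex_map_map_of_injective _ _ (MulAut.conj μ⁻¹).injective,
        Subgroup.relIndex_map_map_of_injective _ _ (q.1.1 : MulAut H).injective]
      exact hfi
  rw [hCT, inv_mem_iff] at htmem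
  -- (C) `t ∈ C m₁ ∩ H₀' ⊆ C k₀ ∩ H₀' ⊆ W'`
  have htC : (f c)⁻¹ * h * μ ∈ C (max m k₀) := hCmul (max m k₀) (inv_mem hfc) hμ hhC
  have htW : (f c)⁻¹ * h * μ ∈ W' := by
    by_contra htW
    have : (f c)⁻¹ * h * μ ∈ (H₀' : Set H) ∩ (W' : Set H)ᶜ ∩ C k₀ :=
      ⟨⟨htmem, htW⟩, hCanti (le_max_right m k₀) htC⟩
    rwa [hk₀] at this
  -- hence `h = (f c) t μ⁻¹ ∈ W'` and `B p = ι'(h) q ∈ levelKer' (N' m)`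
  have hN'W : N' (max m k₀) ≤ W' := (hN'anti (le_max_left m k₀)).trans hNW'
  have hhW : h ∈ W' := by
    have : h = f c * ((f c)⁻¹ * h * μ) * μ⁻¹ := by group
    exact this ▸ mul_mem (mul_mem (hN'W hfc) htW) (inv_mem (hN'W hμ))
  change outerSemidirectProductMap ρG ρH e f hcompat hZ p ∈
    ((P'.levelKer hP' (N' m) (hN'st m) ⊓ U'.toSubgroup.comap (outerSemidirectProductSnd ρH) :
      Subgroup (outerSemidirectProduct ρH)) : Set (outerSemidirectProduct ρH))
  rw [SetLike.mem_coe, Subgroup.mem_inf, Subgroup.mem_comap, outerSemidirectProductSnd_outerSemidirectProductMap]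
  exact ⟨hBp ▸ mul_mem hhW (P'.levelKer_mono hP' (hN'st (max m k₀)) (hN'st m) (hN'anti (le_max_left m k₀)) hq),
    hpU⟩

end Continuity

end Literature.AnabelianGeometry.SemiGraphs
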